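import Summits.HubbardSuperconductivity.HubbardSuperconductivity.Theorems.TwTipContinuation.Negative.SeedContinuity
import Summits.HubbardSuperconductivity.HubbardSuperconductivity.Theorems.CooperPairDMottWalkBreathingAtOneIsPure
import Literature.MathematicalPhysics.QuantumLattice.HubbardLiebTwoHoppingsSector

/-!
# Crux `PbContinuation` (stmt-HubbardSuperconductivity-0907; = `LevyLogBootstrap.Continuation`,
# `AnisotropyChord.Continuation`, `PolyaSchurPairBoson.Continuation`) — ENDPOINT CLOSURE of the
# checkerboard walk `t' → 1` at a fixed side `L` (positive-side support, restatement-invariant)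

The crux continues every-ground-state `d_{x²-y²}` pair-field order of the checkerboard Hubbard tori
`H_L(t',U) = hamiltonian (G ∖ K) 1 U + hamiltonian (G ⊓ K) t' 0` (`G` the torus graph, `K` =
"different `2 × 2` plaquette") from small inter-plaquette hopping `t'` to the uniform point `t' = 1`,
where `H_L(1,U) = hubbardTorus 2 L 1 U` (the landed edge partition
`CooperPairDMottWalk.hamiltonian_sdiff_add_inf`). This file proves the one positive, model-free piece
of that programme which finite-dimensional analysis supplies (the strategist census of the crux,
`Cruxes/PbContinuation/STRATEGY-CENSUS.md` §Transfer T4 / §Decomposition D4, typed it as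
`EndpointClosure`, "provable now"; it is the `t'`-walk analogue of the sibling crux's
`TwTipContinuation.Negative.CornerDanskin.existsGSOrder_pure_of_uniformRungs`), for a GENERAL
two-hopping family `H(t) = hamiltonian X a U + hamiltonian Y t 0` on any finite lattice `Λ`:

* `hamiltonian_zero_eq_smul`, `twoHopping_eq_add_smul`, `re_expect_twoHopping` — the walk is AFFINE:
  `H(t') = H(t) + (t'−t)·T_Y`, `T_Y = hamiltonian Y 1 0`;
* `twoHopping_sector_groundState`, `exists_unit_groundState_twoHopping` — normalised ground states of
  `H(t)` exist in every sector `(2n, S^z = 0)`, `n ≤ |Λ|`, with the variational lower bound;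
* `groundState_of_tendsto` — **closure of the ground-state relation along the walk**: `t_m → t₀`,
  `ψ_m → ψ₀`, `ψ_m` normalised sector ground states of `H(t_m)` ⇒ `ψ₀` is one of `H(t₀)` (limit of
  the variational characterisation + "minimiser ⇒ eigenvector",
  `EigenvalueContinuation.mulVec_eq_smul_of_forall_le_on`; no eigenvalue continuity is needed);
* `exists_groundState_order_of_tendsto` — an every-GS lower bound `B ≤ re⟨ψ, P ψ⟩` (any observable
  `P`) holding at parameters `t_m → t₀` forces SOME normalised sector ground state AT `t₀` with it;
* `exists_nhds_forall_groundState_order` — **the every-GS STRICT bound is an open condition in `t`**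
  (at fixed volume): the finite-volume shadow of "stability of the order along the walk"; what the
  crux needs and this cannot give is volume-uniformity of the neighbourhood;
* `exists_groundState_order_at_one`, `endpointClosure` — the checkerboard instance at the uniform
  point: an every-GS `d`-wave bound on a left neighbourhood `[t₁,1)` gives SOME normalised sector
  ground state of `hubbardTorus 2 L 1 U` with the same bound; eventual-in-`L ∈ 4ℕ` form on the
  crux's own terms = the census's `EndpointClosure U δ` under the guard `-1 ≤ δ` (without which the
  sector is eventually empty and the statement false). Only `∃`: the every-GS conclusion at
  `t' = 1` is not bookkeeping (`TwTipContinuation.Negative.not_abstractUniformRungsShape`); the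
  upgrade under uniqueness is in `Theorems/PbContinuationEndpointUniqueness.lean`.

Nothing here bears on the truth of the crux as typed (an `L`-uniform statement over all `(U,δ)`).
Folklore finite-dimensional analysis (Kato, *Perturbation Theory for Linear Operators* (1966) II
§5.1; Lieb–Wu, Physica A 321 (2003) §2, variational principle in a sector; Tasaki (2020) §2.1–2.2).
No definition is introduced.
-/

noncomputable section

namespace Summit.HubbardSuperconductivity.PbContinuation

open Matrix Filter Topology
open Literature.MathematicalPhysics.QuantumLattice Literature.Probability.LatticeModels
open scoped ComplexOrder

section TwoHopping

variable {Λ : Type*} [LinearOrder Λ] [Fintype Λ]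
variable (X Y : SimpleGraph Λ) [DecidableRel X.Adj] [DecidableRel Y.Adj] (a U : ℝ) {n : ℕ}

/-! ### The walk is affine in the second hopping -/

/-- A pure hopping Hamiltonian is linear in the hopping amplitude:
`hamiltonian Y t 0 = t · hamiltonian Y 1 0`. [folklore] -/
theorem hamiltonian_zero_eq_smul (t : ℝ) : hamiltonian Y t 0 = (t : ℂ) • hamiltonian Y 1 0 := by
  simp only [hamiltonian, Complex.ofReal_zero, zero_smul, add_zero, Complex.ofReal_one, neg_smul,
    one_smul, smul_neg]

/-- `H(t') = H(t) + (t' − t)·T_Y` with `T_Y = hamiltonian Y 1 0`. [folklore] -/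
theorem twoHopping_eq_add_smul (t t' : ℝ) :
    hamiltonian X a U + hamiltonian Y t' 0 =
      hamiltonian X a U + hamiltonian Y t 0 + (((t' - t : ℝ)) : ℂ) • hamiltonian Y 1 0 := by
  rw [hamiltonian_zero_eq_smul Y t', hamiltonian_zero_eq_smul Y t, add_assoc, ← add_smul]
  congr 2
  push_cast
  ring

/-- `re⟨ψ, H(t')ψ⟩ = re⟨ψ, H(t)ψ⟩ + (t' − t)·re⟨ψ, T_Y ψ⟩`. [folklore] -/
theorem re_expect_twoHopping (t t' : ℝ) (ψ : Fock (Orb Λ)) :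
    (expect (hamiltonian X a U + hamiltonian Y t' 0) ψ).re =
      (expect (hamiltonian X a U + hamiltonian Y t 0) ψ).re +
        (t' - t) * (expect (hamiltonian Y 1 0) ψ).re := by
  rw [twoHopping_eq_add_smul X Y a U t t', expect_add, expect_smul, Complex.add_re,
    Complex.re_ofReal_mul]

/-! ### Sector ground states of the two-hopping Hamiltonian -/

/-- **Sector ground states of `H(t)` exist in `(2n, S^z = 0)`, `n ≤ |Λ|`, and the sector energy is a
homogeneous variational lower bound on the sector** (the tree's `LiebTwoHoppings.szSector_groundState₂`,
membership form). Lieb–Wu (2003) §2; Tasaki (2020) §2.2. [folklore] -/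
theorem twoHopping_sector_groundState (t : ℝ) (hn : n ≤ Fintype.card Λ) :
    (∃ ψ, IsGroundStateInSector (hamiltonian X a U + hamiltonian Y t 0) (2 * n) 0 ψ) ∧
      ∀ φ : Fock (Orb Λ), φ ∈ szSector (Λ := Λ) (2 * n) (0 : ℝ) →
        (hamiltonian X a U + hamiltonian Y t 0).minEnergyOn (szSector (2 * n) 0) * (star φ ⬝ᵥ φ).re ≤
          (expect (hamiltonian X a U + hamiltonian Y t 0) φ).re := by
  obtain ⟨hex, hbd⟩ := LiebTwoHoppings.szSector_groundState₂ X Y a t U hn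
  exact ⟨hex, fun φ hφ => hbd φ ((mem_szSector_two_mul_zero_iff n φ).1 hφ)⟩

/-- Normalised sector ground states of `H(t)` exist in every sector `(2n, 0)`, `n ≤ |Λ|`. [folklore] -/
theorem exists_unit_groundState_twoHopping (t : ℝ) (hn : n ≤ Fintype.card Λ) :
    ∃ ψ : Fock (Orb Λ), star ψ ⬝ᵥ ψ = 1 ∧
      IsGroundStateInSector (hamiltonian X a U + hamiltonian Y t 0) (2 * n) 0 ψ := by
  obtain ⟨⟨ψ, hψ⟩, -⟩ := twoHopping_sector_groundState X Y a U t hn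
  obtain ⟨c, hc, hc1⟩ := Literature.MathematicalPhysics.QuantumLattice.exists_smul_unit hψ.2.1
  exact ⟨c • ψ, hc1, Summit.HubbardSuperconductivity.NoGo.isGroundStateInSector_smul _ _ _ hψ hc⟩

/-- For a normalised sector ground state, `⟨ψ, H ψ⟩` is the sector energy. [folklore] -/
theorem expect_eq_sectorEnergy {H : Matrix (Finset (Orb Λ)) (Finset (Orb Λ)) ℂ}
    {N : ℕ} {M : ℝ} {ψ : Fock (Orb Λ)} (hψ1 : star ψ ⬝ᵥ ψ = 1) (h : IsGroundStateInSector H N M ψ) :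
    expect H ψ = ((H.minEnergyOn (szSector N M) : ℝ) : ℂ) := by
  rw [Literature.MathematicalPhysics.QuantumLattice.expect, h.2.2, dotProduct_smul, hψ1, smul_eq_mul,
    mul_one]

/-- Bolzano–Weierstrass on the unit sphere `{ψ | ⟨ψ,ψ⟩ = 1}` of a Fock space. [folklore] -/
theorem exists_tendsto_subseq_of_unit {ι : Type*} [Fintype ι] {ψ : ℕ → (ι → ℂ)}
    (hunit : ∀ m, star (ψ m) ⬝ᵥ ψ m = 1) :
    ∃ ψ₀ : ι → ℂ, ∃ φ : ℕ → ℕ, StrictMono φ ∧ Tendsto (ψ ∘ φ) atTop (𝓝 ψ₀) := by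
  have hK := EigenvalueContinuation.isCompact_unitSphere_inter (⊤ : Submodule ℂ (ι → ℂ))
  obtain ⟨ψ₀, -, φ, hφ, hlim⟩ := hK.tendsto_subseq (x := ψ) fun m => ⟨Submodule.mem_top, hunit m⟩
  exact ⟨ψ₀, φ, hφ, hlim⟩

/-! ### Closure of the ground-state relation along the walk -/

/-- **Closure of sector ground states along the walk.** If `t_m → t₀`, `ψ_m → ψ₀` and every `ψ_m`
is a normalised sector ground state of `H(t_m)`, then `ψ₀` is a normalised sector ground state of
`H(t₀)`: normalisation and the coordinate description of the sector pass to the limit, the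
variational inequalities `re⟨ψ_m,H(t_m)ψ_m⟩ ≤ re⟨φ,H(t_m)φ⟩` pass to the limit by joint continuity
of the affine family, and a minimiser of the quadratic form on the invariant sector is an eigenvector
for the sector energy (`EigenvalueContinuation.mulVec_eq_smul_of_forall_le_on`). Kato (1966) II §5.1;
Lieb–Wu (2003) §2. [folklore] -/
theorem groundState_of_tendsto (hn : n ≤ Fintype.card Λ) {t : ℕ → ℝ} {t₀ : ℝ}
    (ht : Tendsto t atTop (𝓝 t₀)) {ψ : ℕ → Fock (Orb Λ)} {ψ₀ : Fock (Orb Λ)}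
    (hψ : Tendsto ψ atTop (𝓝 ψ₀)) (hunit : ∀ m, star (ψ m) ⬝ᵥ ψ m = 1)
    (hgs : ∀ m, IsGroundStateInSector (hamiltonian X a U + hamiltonian Y (t m) 0) (2 * n) 0 (ψ m)) :
    star ψ₀ ⬝ᵥ ψ₀ = 1 ∧
      IsGroundStateInSector (hamiltonian X a U + hamiltonian Y t₀ 0) (2 * n) 0 ψ₀ := by
  -- normalisation passes to the limit
  have hcont : Continuous fun w : Fock (Orb Λ) => star w ⬝ᵥ w := by
    simp only [dotProduct, Pi.star_apply, Complex.star_def]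
    fun_prop
  have hunit₀ : star ψ₀ ⬝ᵥ ψ₀ = 1 := by
    have h1 : Tendsto (fun m => star (ψ m) ⬝ᵥ ψ m) atTop (𝓝 (star ψ₀ ⬝ᵥ ψ₀)) :=
      (hcont.tendsto ψ₀).comp hψ
    have h2 : Tendsto (fun m => star (ψ m) ⬝ᵥ ψ m) atTop (𝓝 1) := by
      simp only [hunit]
      exact tendsto_const_nhds
    exact tendsto_nhds_unique h1 h2
  -- sector membership passes to the limit (coordinate description)
  have hmem : ψ₀ ∈ szSector (Λ := Λ) (2 * n) (0 : ℝ) := by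
    rw [mem_szSector_two_mul_zero_iff]
    intro s hs
    have hco : Tendsto (fun m => ψ m s) atTop (𝓝 (ψ₀ s)) :=
      ((continuous_apply s).tendsto ψ₀).comp hψ
    have hz : (fun m => ψ m s) = fun _ => 0 :=
      funext fun m => ((mem_szSector_two_mul_zero_iff n (ψ m)).1 (hgs m).1) s hs
    rw [hz] at hco
    exact (tendsto_nhds_unique tendsto_const_nhds hco).symm
  have hne : ψ₀ ≠ 0 := by
    intro h
    rw [h, dotProduct_zero] at hunit₀
    exact zero_ne_one hunit₀
  -- the variational characterisation passes to the limit
  obtain ⟨-, hbd₀⟩ := twoHopping_sector_groundState X Y a U t₀ hn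
  obtain ⟨φ, hφu, hφgs⟩ := exists_unit_groundState_twoHopping X Y a U t₀ hn
  have hEm_le : ∀ m, (expect (hamiltonian X a U + hamiltonian Y (t m) 0) (ψ m)).re ≤
      (expect (hamiltonian X a U + hamiltonian Y (t m) 0) φ).re := by
    intro m
    obtain ⟨-, hbd⟩ := twoHopping_sector_groundState X Y a U (t m) hn
    have h1 := hbd φ hφgs.1
    rw [hφu, Complex.one_re, mul_one] at h1
    rw [expect_eq_sectorEnergy (hunit m) (hgs m), Complex.ofReal_re]
    exact h1
  -- right side: `re⟨φ, H(t_m) φ⟩ → re⟨φ, H(t₀) φ⟩ = E(t₀)`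
  have hR : Tendsto (fun m => (expect (hamiltonian X a U + hamiltonian Y (t m) 0) φ).re) atTop
      (𝓝 ((hamiltonian X a U + hamiltonian Y t₀ 0).minEnergyOn (szSector (2 * n) 0))) := by
    have hφE : (expect (hamiltonian X a U + hamiltonian Y t₀ 0) φ).re =
        (hamiltonian X a U + hamiltonian Y t₀ 0).minEnergyOn (szSector (2 * n) 0) := by
      rw [expect_eq_sectorEnergy hφu hφgs, Complex.ofReal_re]
    have h0 : Tendsto (fun m => (t m - t₀) * (expect (hamiltonian Y 1 0) φ).re) atTop (𝓝 0) := by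
      have h := (ht.sub_const t₀).mul_const (expect (hamiltonian Y 1 0) φ).re
      rwa [sub_self, zero_mul] at h
    have h := h0.const_add (expect (hamiltonian X a U + hamiltonian Y t₀ 0) φ).re
    rw [add_zero] at h
    rw [← hφE]
    refine h.congr' (Eventually.of_forall fun m => ?_)
    exact (re_expect_twoHopping X Y a U t₀ (t m) φ).symm
  -- left side: `re⟨ψ_m, H(t_m) ψ_m⟩ → re⟨ψ₀, H(t₀) ψ₀⟩`
  have hL : Tendsto (fun m => (expect (hamiltonian X a U + hamiltonian Y (t m) 0) (ψ m)).re) atTop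
      (𝓝 ((expect (hamiltonian X a U + hamiltonian Y t₀ 0) ψ₀).re)) := by
    have h1 : Tendsto (fun m => (expect (hamiltonian X a U + hamiltonian Y t₀ 0) (ψ m)).re) atTop
        (𝓝 ((expect (hamiltonian X a U + hamiltonian Y t₀ 0) ψ₀).re)) :=
      ((EigenvalueContinuation.continuous_energy (hamiltonian X a U + hamiltonian Y t₀ 0)).tendsto
        ψ₀).comp hψ
    have h2 : Tendsto (fun m => (expect (hamiltonian Y 1 0) (ψ m)).re) atTop
        (𝓝 ((expect (hamiltonian Y 1 0) ψ₀).re)) :=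
      ((EigenvalueContinuation.continuous_energy (hamiltonian Y 1 0)).tendsto ψ₀).comp hψ
    have h3 : Tendsto (fun m => (t m - t₀) * (expect (hamiltonian Y 1 0) (ψ m)).re) atTop (𝓝 0) := by
      have h := (ht.sub_const t₀).mul h2
      rwa [sub_self, zero_mul] at h
    have h4 := h1.add h3
    rw [add_zero] at h4
    refine h4.congr' (Eventually.of_forall fun m => ?_)
    exact (re_expect_twoHopping X Y a U t₀ (t m) (ψ m)).symm
  have hle : (expect (hamiltonian X a U + hamiltonian Y t₀ 0) ψ₀).re ≤
      (hamiltonian X a U + hamiltonian Y t₀ 0).minEnergyOn (szSector (2 * n) 0) :=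
    le_of_tendsto_of_tendsto' hL hR hEm_le
  -- variational principle on the invariant sector ⇒ eigen-equation with the sector energy
  have hA := (LiebTwoHoppings.hamiltonian₂_isHermitian X Y a t₀ U).eq
  have hW : ∀ v ∈ szSector (Λ := Λ) (2 * n) (0 : ℝ),
      (hamiltonian X a U + hamiltonian Y t₀ 0) *ᵥ v ∈ szSector (Λ := Λ) (2 * n) (0 : ℝ) := by
    intro v hv
    rw [mem_szSector_two_mul_zero_iff] at hv ⊢
    exact (LiebTwoHoppings.preservesSectors_hamiltonian₂ X Y a t₀ U).isInSector_mulVec hv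
  have heig := EigenvalueContinuation.mulVec_eq_smul_of_forall_le_on hA (szSector (2 * n) 0) hW
    (fun v hv => hbd₀ v hv) hmem (by rw [hunit₀, Complex.one_re, mul_one]; exact hle)
  exact ⟨hunit₀, hmem, hne, heig⟩

/-! ### Endpoint closure: a bound along `t_m → t₀` survives for SOME ground state at `t₀` -/

/-- **Closure of an every-GS order bound.** If along parameters `t_m → t₀` EVERY normalised sector
ground state of `H(t_m)` has `B ≤ re⟨ψ, P ψ⟩` (`P` any observable, e.g. `Δ_dᴴΔ_d`), then SOME
normalised sector ground state of `H(t₀)` has the same bound (ground states along the sequence,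
Bolzano–Weierstrass, closure of the ground-state relation, continuity of `ψ ↦ re⟨ψ, P ψ⟩`). Nothing
is asserted about the OTHER ground states at `t₀`. Kato (1966) II §5.1. [folklore] -/
theorem exists_groundState_order_of_tendsto (P : Matrix (Finset (Orb Λ)) (Finset (Orb Λ)) ℂ)
    (hn : n ≤ Fintype.card Λ) {B : ℝ} {t : ℕ → ℝ} {t₀ : ℝ} (ht : Tendsto t atTop (𝓝 t₀))
    (h : ∀ m, ∀ ψ : Fock (Orb Λ), star ψ ⬝ᵥ ψ = 1 →
      IsGroundStateInSector (hamiltonian X a U + hamiltonian Y (t m) 0) (2 * n) 0 ψ →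
        B ≤ (expect P ψ).re) :
    ∃ ψ : Fock (Orb Λ), star ψ ⬝ᵥ ψ = 1 ∧
      IsGroundStateInSector (hamiltonian X a U + hamiltonian Y t₀ 0) (2 * n) 0 ψ ∧
        B ≤ (expect P ψ).re := by
  have hex : ∀ m : ℕ, ∃ ψ : Fock (Orb Λ), star ψ ⬝ᵥ ψ = 1 ∧
      IsGroundStateInSector (hamiltonian X a U + hamiltonian Y (t m) 0) (2 * n) 0 ψ :=
    fun m => exists_unit_groundState_twoHopping X Y a U (t m) hn
  choose ψ hψu hψgs using hex
  obtain ⟨ψ₀, φ, hφ, hlim⟩ := exists_tendsto_subseq_of_unit hψu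
  obtain ⟨hu₀, hgs₀⟩ := groundState_of_tendsto X Y a U hn (ht.comp hφ.tendsto_atTop) hlim
    (fun m => hψu (φ m)) (fun m => hψgs (φ m))
  have hPlim : Tendsto (fun m => (expect P (ψ (φ m))).re) atTop (𝓝 ((expect P ψ₀).re)) :=
    ((EigenvalueContinuation.continuous_energy P).tendsto ψ₀).comp hlim
  exact ⟨ψ₀, hu₀, hgs₀, ge_of_tendsto' hPlim fun m => h (φ m) (ψ (φ m)) (hψu (φ m)) (hψgs (φ m))⟩

/-- **The every-GS STRICT bound is an open condition in the second hopping (fixed volume).** If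
every normalised sector ground state of `H(t₀)` has `B < re⟨ψ, P ψ⟩`, then the same holds at every
`t` in a neighbourhood of `t₀` (near-by dark ground states would accumulate at a dark ground state
at `t₀`). This is the finite-volume form of "no transition near `t₀`"; the radius depends on the
volume, and a volume-uniform radius is exactly what a continuation of order would need.
Kato (1966) II §5.1. [folklore] -/
theorem exists_nhds_forall_groundState_order (P : Matrix (Finset (Orb Λ)) (Finset (Orb Λ)) ℂ)
    (hn : n ≤ Fintype.card Λ) {B : ℝ} (t₀ : ℝ)
    (h : ∀ ψ : Fock (Orb Λ), star ψ ⬝ᵥ ψ = 1 →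
      IsGroundStateInSector (hamiltonian X a U + hamiltonian Y t₀ 0) (2 * n) 0 ψ →
        B < (expect P ψ).re) :
    ∃ ε : ℝ, 0 < ε ∧ ∀ t : ℝ, |t - t₀| < ε → ∀ ψ : Fock (Orb Λ), star ψ ⬝ᵥ ψ = 1 →
      IsGroundStateInSector (hamiltonian X a U + hamiltonian Y t 0) (2 * n) 0 ψ →
        B < (expect P ψ).re := by
  by_contra hcon
  push Not at hcon
  -- dark ground states at parameters `t_m`, `|t_m − t₀| < 1/(m+1)`
  have hex : ∀ m : ℕ, ∃ t : ℝ, |t - t₀| < 1 / ((m : ℝ) + 1) ∧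
      ∃ ψ : Fock (Orb Λ), star ψ ⬝ᵥ ψ = 1 ∧
        IsGroundStateInSector (hamiltonian X a U + hamiltonian Y t 0) (2 * n) 0 ψ ∧
          (expect P ψ).re ≤ B :=
    fun m => hcon (1 / ((m : ℝ) + 1)) (by positivity)
  choose t ht ψ hψu hψgs hψB using hex
  have hlimt : Tendsto t atTop (𝓝 t₀) := by
    have h0 : Tendsto (fun m : ℕ => 1 / ((m : ℝ) + 1)) atTop (𝓝 0) :=
      tendsto_one_div_add_atTop_nhds_zero_nat (𝕜 := ℝ)
    have habs : Tendsto (fun m => |t m - t₀|) atTop (𝓝 0) :=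
      squeeze_zero (fun m => abs_nonneg _) (fun m => (ht m).le) h0
    have hsub : Tendsto (fun m => t m - t₀) atTop (𝓝 0) :=
      (tendsto_zero_iff_abs_tendsto_zero _).2 habs
    have h1 := hsub.add_const t₀
    rw [zero_add] at h1
    exact h1.congr fun m => by ring
  obtain ⟨ψ₀, φ, hφ, hlim⟩ := exists_tendsto_subseq_of_unit hψu
  obtain ⟨hu₀, hgs₀⟩ := groundState_of_tendsto X Y a U hn (hlimt.comp hφ.tendsto_atTop) hlim
    (fun m => hψu (φ m)) (fun m => hψgs (φ m))
  have hPlim : Tendsto (fun m => (expect P (ψ (φ m))).re) atTop (𝓝 ((expect P ψ₀).re)) :=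
    ((EigenvalueContinuation.continuous_energy P).tendsto ψ₀).comp hlim
  have hle : (expect P ψ₀).re ≤ B := le_of_tendsto' hPlim fun m => hψB (φ m)
  exact absurd (h ψ₀ hu₀ hgs₀) (not_lt.2 hle)

end TwoHopping

/-! ### The checkerboard walk at its endpoint `t' = 1`: the pure Hubbard torus -/

/-- **Endpoint closure at the uniform point, one side.** If on a left neighbourhood `[t₁, 1)` of the
uniform point EVERY normalised `(2n, S^z=0)`-sector ground state of the checkerboard torus
`H_L(t',U) = hamiltonian (G ∖ K) 1 U + hamiltonian (G ⊓ K) t' 0` has `B ≤ re⟨ψ, Δ_dᴴΔ_d ψ⟩`, then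
SOME normalised sector ground state of the pure torus `hubbardTorus 2 L 1 U = H_L(1,U)` has
`B ≤ re⟨ψ, Δ_dᴴΔ_d ψ⟩` (`n ≤ L²`; walk `t'_m = 1 − (1−t₁)/(2(m+1))`, endpoint identity
`hamiltonian_sdiff_add_inf`). Kato (1966) II §5.1; Lieb–Wu (2003) §2. [folklore] -/
theorem exists_groundState_order_at_one :
    ∀ (U : ℝ) (L : ℕ) [NeZero L] (n : ℕ), n ≤ L ^ 2 → ∀ (B t₁ : ℝ), t₁ < 1 →
      (∀ t' ∈ Set.Ico t₁ 1, ∀ ψ : Fock (Orb (FermionTorus 2 L)), star ψ ⬝ᵥ ψ = 1 →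
        IsGroundStateInSector
          (hamiltonian ((fermionTorusGraph 2 L) \ SimpleGraph.comap
              (fun x : FermionTorus 2 L => fun i : Fin 2 => ((ofLex x) i : ℕ) / 2) ⊤) 1 U +
            hamiltonian ((fermionTorusGraph 2 L) ⊓ SimpleGraph.comap
              (fun x : FermionTorus 2 L => fun i : Fin 2 => ((ofLex x) i : ℕ) / 2) ⊤) t' 0) (2 * n) 0 ψ →
          B ≤ (expect ((pairField dWaveFormFactor L)ᴴ * pairField dWaveFormFactor L) ψ).re) →
      ∃ ψ : Fock (Orb (FermionTorus 2 L)), star ψ ⬝ᵥ ψ = 1 ∧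
        IsGroundStateInSector (hubbardTorus 2 L 1 U) (2 * n) 0 ψ ∧
          B ≤ (expect ((pairField dWaveFormFactor L)ᴴ * pairField dWaveFormFactor L) ψ).re := by
  intro U L _ n hn B t₁ ht₁ h
  have hn' : n ≤ Fintype.card (FermionTorus 2 L) := by
    rwa [Summit.HubbardSuperconductivity.NoGo.card_fermionTorus_two]
  -- the walk `t'_m = 1 − (1 − t₁)/2 · 1/(m+1) ∈ [t₁, 1)`, `t'_m → 1`
  set t : ℕ → ℝ := fun m => 1 - (1 - t₁) / 2 * (1 / ((m : ℝ) + 1)) with ht_def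
  have hmem : ∀ m, t m ∈ Set.Ico t₁ 1 := by
    intro m
    have hm : (0 : ℝ) < (m : ℝ) + 1 := by positivity
    have h1 : 0 < 1 / ((m : ℝ) + 1) := by positivity
    have h2 : 1 / ((m : ℝ) + 1) ≤ 1 := by
      rw [div_le_one hm]
      linarith [(m.cast_nonneg : (0 : ℝ) ≤ m)]
    have h3 : 0 < 1 - t₁ := by linarith
    constructor
    · change t₁ ≤ 1 - (1 - t₁) / 2 * (1 / ((m : ℝ) + 1))
      nlinarith
    · change 1 - (1 - t₁) / 2 * (1 / ((m : ℝ) + 1)) < 1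
      nlinarith
  have hlim : Tendsto t atTop (𝓝 1) := by
    have h0 : Tendsto (fun m : ℕ => 1 / ((m : ℝ) + 1)) atTop (𝓝 0) :=
      tendsto_one_div_add_atTop_nhds_zero_nat (𝕜 := ℝ)
    have h1 := (h0.const_mul ((1 - t₁) / 2)).const_sub 1
    rwa [mul_zero, sub_zero] at h1
  obtain ⟨ψ, hψu, hψgs, hB⟩ := exists_groundState_order_of_tendsto _ _ 1 U
    ((pairField dWaveFormFactor L)ᴴ * pairField dWaveFormFactor L) hn' hlim
    (fun m ψ hψ hgs => h (t m) (hmem m) ψ hψ hgs)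
  refine ⟨ψ, hψu, ?_, hB⟩
  rwa [Summit.HubbardSuperconductivity.HubbardSuperconductivity.Theorems.CooperPairDMottWalk.hamiltonian_sdiff_add_inf
    _ _ 1 U] at hψgs

/-- **ENDPOINT CLOSURE on the crux's terms** (the census's `EndpointClosure U δ`, guarded by
`-1 ≤ δ`): an every-ground-state `d_{x²-y²}` order bound `c L⁴ ≤ re⟨ψ, Δ_dᴴΔ_d ψ⟩`, uniform on a
left neighbourhood `[t₁,1)` of the uniform point and eventual along `L ∈ 4ℕ`, for the checkerboard
tori in the sector `(2⌊(1-δ)L²/2⌋, S^z = 0)`, gives at every such `L` SOME normalised sector ground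
state of the pure torus `hubbardTorus 2 L 1 U` with the same bound. Only `∃`: the every-GS
conclusion at `t' = 1` is not a consequence of bookkeeping
(`TwTipContinuation.Negative.not_abstractUniformRungsShape`). Kato (1966) II §5.1. [folklore] -/
theorem endpointClosure :
    ∀ (U δ : ℝ), -1 ≤ δ →
      (∃ t₁ ∈ Set.Ioo (0:ℝ) 1, ∃ c : ℝ, 0 < c ∧ ∃ L₀ : ℕ, ∀ (L : ℕ) [NeZero L], L₀ ≤ L → 4 ∣ L →
        ∀ t' ∈ Set.Ico t₁ 1, ∀ ψ : Fock (Orb (FermionTorus 2 L)), star ψ ⬝ᵥ ψ = 1 →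
          IsGroundStateInSector
            (hamiltonian ((fermionTorusGraph 2 L) \ SimpleGraph.comap
                (fun x : FermionTorus 2 L => fun i : Fin 2 => ((ofLex x) i : ℕ) / 2) ⊤) 1 U +
              hamiltonian ((fermionTorusGraph 2 L) ⊓ SimpleGraph.comap
                (fun x : FermionTorus 2 L => fun i : Fin 2 => ((ofLex x) i : ℕ) / 2) ⊤) t' 0)
            (2 * ⌊(1 - δ) * (L : ℝ) ^ 2 / 2⌋₊) 0 ψ →
            c * (L : ℝ) ^ 4 ≤ (expect ((pairField dWaveFormFactor L)ᴴ * pairField dWaveFormFactor L) ψ).re) →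
      ∃ c : ℝ, 0 < c ∧ ∃ L₀ : ℕ, ∀ (L : ℕ) [NeZero L], L₀ ≤ L → 4 ∣ L →
        ∃ ψ : Fock (Orb (FermionTorus 2 L)), star ψ ⬝ᵥ ψ = 1 ∧
          IsGroundStateInSector (hubbardTorus 2 L 1 U) (2 * ⌊(1 - δ) * (L : ℝ) ^ 2 / 2⌋₊) 0 ψ ∧
            c * (L : ℝ) ^ 4 ≤ (expect ((pairField dWaveFormFactor L)ᴴ * pairField dWaveFormFactor L) ψ).re := by
  intro U δ hδ h
  obtain ⟨t₁, ht₁, c, hc, L₀, hL⟩ := h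
  refine ⟨c, hc, L₀, fun L _ hL₀ h4 => ?_⟩
  exact exists_groundState_order_at_one U L _
    (Summit.HubbardSuperconductivity.NoGo.floor_pairNumber_le δ hδ L) _ t₁ ht₁.2
    (fun t' ht' ψ hψ hgs => hL L hL₀ h4 t' ht' ψ hψ hgs)

end Summit.HubbardSuperconductivity.PbContinuation

end
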